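import Summits.BirchSwinnertonDyer.BirchSwinnertonDyer.Theorems.ByReductionTypeAtTwoRankOneAtTwoBigImageOddLocalOneDoorPairLedger
import Literature.NumberTheory.EllipticCurves.QuadraticTwistRank
import Literature.NumberTheory.EllipticCurves.BSDInvariantsProofs
import HarnessLib

/-!
# Route ByReductionTypeAtTwo, crux `RankOneAtTwoBigImageOddLocal` (stmt-BirchSwinnertonDyer-23715), LINE v8.6 `one_door_analytic`:
# PRINT-ONLY: the analytic `Ш` orders of a door pair have the SAME `2`-adic parity

Width prover seat `bsd-line-fkl-p2` g8 (2026-08-28), `--supports stmt-BirchSwinnertonDyer-23715`.  THEOREMS ONLY; nothing is asserted;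
BSD is not proved by any of this.  Sequel of `…OneDoorPairLedger.lean` (p629541: `ord₂ #Ш_an(W) + ord₂ q_d = 2m + [Δ_W<0] − 2·v₂(c)`).

No `BSD₂` input, no Cassels–Tate: only Gross–Zagier / Kolyvagin at `(N_E, W, K)`, modularity as a newform (for the datum of the twin and
the rationality of `L(Wd,1)/Ω(Wd)` by modular symbols), the PROVED twist Tamagawa law `doorTwistTamagawaAtTwo` (p616165) and the lead's
PROVED parity of the transposition count (`transpCount_mod_two_of_doorAdmissible`, p624716).

* §1 `pairShaAnLedger_at` — at a door datum (`W` on the slice with `rank E(ℚ) = 1`, `K` door-admissible Heegner field with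
  `L(E^{(d_K)},1) ≠ 0`, ANY datum `Dt`, the Heegner point `P`, a globally minimal twin `Wd`): `rank Wd(ℚ) = 0` (Kolyvagin over `K`:
  `rank E(K) = 1 = rank E(ℚ) + rank E^{(d_K)}(ℚ)`), and `#Ш_an(W)`, `#Ш_an(Wd)` are non-zero rationals `q`, `q'` with
  **`ord₂ q + ord₂ q' + t + 2s = 2m + [Δ_W<0] − 2·v₂(c)`** (`#Ш_an(Wd) = q_d·#Wd(ℚ)_tors²/∏c_ℓ(Wd)`, odd torsion, `v₂ ∏c_ℓ(Wd) = t + 2s`).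
* §2 `even_padicValRat_shaAn_add_shaAn_twin_at` — hence **`ord₂ #Ш_an(W) + ord₂ #Ш_an(Wd)` is EVEN** (`t ≡ [Δ_W<0] (mod 2)`): the two
  members of a door pair have analytic `Ш` orders of the same `2`-adic parity — as BSD + Cassels–Tate predict (both squares), but here a
  theorem modulo PRINT only.  A row-by-row sanity identity for the census engines (ENGINE L / modular symbols) that presupposes nothing open.
* §3 `exists_twin_even_padicValRat_shaAn_add_onSlice` — for every `W` on the slice of 23715 there IS such a door twin (Hoffstein–Luo), modulo
  the four primary facts only.

References: [GrossZagier1986] Thm. I.6.3, V.§2; [Kramer1981] Prop. 3; [Miller2011LMS] Def. 1.1.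
-/

set_option autoImplicit false

noncomputable section

open scoped Classical

set_option linter.dupNamespace false

namespace Summit.BirchSwinnertonDyer.BirchSwinnertonDyer.Theorems.RankOneAtTwoOneDoor

open WeierstrassCurve NumberField IsDedekindDomain Rat.HeightOneSpectrum Literature.NumberTheory.EllipticCurves
  Literature.NumberTheory.EllipticCurves.ModularForms
  Literature.NumberTheory.EllipticCurves.KrizLi2019
  Literature.NumberTheory.EllipticCurves.Rank1Residual.Typed
  Summit.BirchSwinnertonDyer.Rank1Residual.F1Sign2
  Summit.BirchSwinnertonDyer.Rank1Residual.F1Sign2.TranspositionDoor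
  Summit.BirchSwinnertonDyer.Rank1Residual
  Summit.BirchSwinnertonDyer.BirchSwinnertonDyer.Theses.ByReductionTypeAtTwo

/-! ### §0 Two print-level inputs: `L(V,1)/Ω(V) ∈ ℚ` by modular symbols, and the rank of the twin -/

/-- **`L(V,1)/Ω(V)` is rational** for a globally minimal `V/ℚ`, modulo modularity as a newform (`exists_isNewformOf`): modular symbols,
`L(V,1) = [0]⁺_f · Ω⁺_f` and `Ω⁺_f = ϖ · Ω(V)` (`IsNewformOf.entireLFunction_one_eq`, `exists_rat_mul_realPeriodRat_eq_plusPeriod`).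
[cite: Cremona1997, §2.8] -/
theorem exists_rat_lOne_div_realPeriodRat_of_exists_isNewformOf (hnf : exists_isNewformOf)
    (V : WeierstrassCurve ℚ) [V.IsElliptic] [V.IsGloballyMinimal] :
    ∃ q : ℚ, V.entireLFunction 1 / (V.realPeriodRat : ℂ) = (q : ℂ) := by
  haveI : NeZero (V.conductorNorm ℤ) := ⟨(V.conductorNorm_pos_holds).ne'⟩
  obtain ⟨Dm⟩ := (nonempty_modularParametrizationData_iff_exists_isNewformOf_unconditional.mpr hnf) V
  have hf : IsNewformOf V Dm.f := Dm.isNewformOf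
  obtain ⟨ϖ, -, hϖeq, hΩpos⟩ := Dm.exists_rat_mul_realPeriodRat_eq_plusPeriod
  refine ⟨ϖ * ratPlusSymbol Dm.f 0, ?_⟩
  rw [hf.entireLFunction_one_eq, ← hϖeq, div_eq_iff (Complex.ofReal_ne_zero.mpr hΩpos.ne')]
  push_cast
  ring

/-- **The twin of a rank-one door has Mordell–Weil rank `0`**: `rank E(K) = rank E(ℚ) + rank E^{(d_K)}(ℚ)`
(`mordellWeilRank_add_eq_of_baseChange`) with `rank E(K) = 1` (Kolyvagin) and `rank E(ℚ) = 1`; invariance under the change of variables to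
the minimal model. [cite: SilvermanAEC2009, Ex. X.10.16] -/
theorem mordellWeilRank_twin_eq_zero (W : WeierstrassCurve ℚ) [W.IsElliptic] (K : Type) [Field K] [NumberField K]
    (h2 : Module.finrank ℚ K = 2) (hrkK : (W.baseChange K).mordellWeilRank = 1) (hrQ : W.mordellWeilRank = 1)
    (Wd : WeierstrassCurve ℚ) (Cd : VariableChange ℚ) (hWd : Cd • W.quadraticTwist (NumberField.discr K : ℚ) = Wd) :
    Wd.mordellWeilRank = 0 := by
  have hD0 : (NumberField.discr K : ℚ) ≠ 0 := by exact_mod_cast NumberField.discr_ne_zero K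
  haveI hEt : (W.quadraticTwist (NumberField.discr K : ℚ)).IsElliptic := W.isElliptic_quadraticTwist hD0
  have hsum := W.mordellWeilRank_add_eq_of_baseChange K h2 one_ne_zero hrkK
  have htw : (W.quadraticTwist (NumberField.discr K : ℚ)).mordellWeilRank = 0 := by omega
  rw [← hWd, show (Cd • W.quadraticTwist (NumberField.discr K : ℚ)).mordellWeilRank =
      (W.quadraticTwist (NumberField.discr K : ℚ)).mordellWeilRank
    from mordellWeilRank_variableChange_holds (W.quadraticTwist (NumberField.discr K : ℚ)) Cd]
  exact htw

/-! ### §1 The pair ledger in `Ш_an`-currency on both sides -/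

/-- **THE `2`-ADIC LEDGER OF A DOOR PAIR IN `Ш_an`-CURRENCY, PRINT ONLY.**  `W/ℚ` globally minimal, odd `#E(ℚ)_tors`, odd `∏ c_ℓ`, analytic
rank `1`, `rank E(ℚ) = 1`; `K` imaginary quadratic with `d_K` door-admissible, the Heegner hypothesis and `L(E^{(d_K)},1) ≠ 0`; `Dt` ANY
datum, `H`, `ι`, `P` the Heegner point; `Wd` a globally minimal model of the twist; Gross–Zagier / Kolyvagin at `(N_E, W, K)` and
modularity as a newform.  THEN `rank Wd(ℚ) = 0` and `#Ш_an(W)`, `#Ш_an(Wd)` are non-zero rationals `q`, `q'` with, for the (unique)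
exponent `m` of `P`, **`ord₂ q + ord₂ q' + t + 2s = 2m + [Δ_W<0] − 2·v₂(c)`**.  [cite: GrossZagier1986, Thm. I.6.3 and V.§2]
[cite: Kramer1981, Prop. 3] [cite: Miller2011LMS, Def. 1.1] -/
theorem pairShaAnLedger_at (hnf : exists_isNewformOf)
    (W : WeierstrassCurve ℚ) [W.IsElliptic] [W.IsGloballyMinimal] [NeZero (W.conductorNorm ℤ)]
    (hT : Odd W.torsionOrder) (hc : Odd W.tamagawaProduct) (hr : W.analyticRank = 1) (hrQ : W.mordellWeilRank = 1)
    (K : Type) [Field K] [NumberField K] (hK : IsImaginaryQuadratic K)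
    (hGZ : gross_zagier (W.conductorNorm ℤ) W K) (hKo : kolyvagin (W.conductorNorm ℤ) W K)
    (hadm : DoorAdmissible W (NumberField.discr K))
    (hHN : SatisfiesHeegnerHypothesis (W.conductorNorm ℤ) K)
    (hLt : (W.quadraticTwist (NumberField.discr K : ℚ)).entireLFunction 1 ≠ 0)
    (Dt : ModularParametrizationData W (W.conductorNorm ℤ))
    (H : HeegnerDatum (W.conductorNorm ℤ) (NumberField.discr K)) (ι : K →+* ℂ)
    (P : (W.baseChange K).toAffine.Point)
    (hP : WeierstrassCurve.Affine.Point.map ι.toRatAlgHom P = heegnerPointComplex Dt H)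
    (Wd : WeierstrassCurve ℚ) [Wd.IsElliptic] [Wd.IsGloballyMinimal] (Cd : VariableChange ℚ)
    (hWd : Cd • W.quadraticTwist (NumberField.discr K : ℚ) = Wd) :
    Wd.mordellWeilRank = 0 ∧ (∃ m : ℕ, HasTwoDivisibilityUpToTorsion W K P m) ∧
      ∃ q q' : ℚ, shaAn W = (q : ℂ) ∧ shaAn Wd = (q' : ℂ) ∧ q ≠ 0 ∧ q' ≠ 0 ∧
        ∀ m : ℕ, HasTwoDivisibilityUpToTorsion W K P m →
          padicValRat 2 q + padicValRat 2 q' + (transpCount W (NumberField.discr K) : ℤ) +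
              2 * (identCount W (NumberField.discr K) : ℤ) =
            2 * (m : ℤ) + ((if W.Δ < 0 then 1 else 0 : ℕ) : ℤ) - 2 * (padicValInt 2 Dt.c : ℤ) := by
  haveI : Fact (Nat.Prime 2) := ⟨Nat.prime_two⟩
  have hmod : hasEntireLFunction_rat := hasEntireLFunction_rat_of_exists_isNewformOf hnf
  have h2 : Module.finrank ℚ K = 2 := hK.1
  have hD0 : (NumberField.discr K : ℚ) ≠ 0 := by exact_mod_cast NumberField.discr_ne_zero K
  haveI hEt : (W.quadraticTwist (NumberField.discr K : ℚ)).IsElliptic := W.isElliptic_quadraticTwist hD0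
  -- `q_d = L(Wd,1)/Ω(Wd) ∈ ℚ` by modular symbols, and the print-only ledger
  obtain ⟨qd, hqd⟩ := exists_rat_lOne_div_realPeriodRat_of_exists_isNewformOf hnf Wd
  obtain ⟨-, hrkK, -, hexm, -, hqd0, q, hq, hq0, hval⟩ :=
    pairLedgerC_at hmod W hT hc hr hrQ K hK hGZ hKo hadm hHN hLt Dt H ι P hP Wd Cd hWd qd hqd
  -- the twin: rank `0`, analytic rank `0`, odd torsion, `v₂ ∏c_ℓ(Wd) = t + 2s`
  have hrkd : Wd.mordellWeilRank = 0 := mordellWeilRank_twin_eq_zero W K h2 hrkK hrQ Wd Cd hWd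
  have hLeq : Wd.entireLFunction = (W.quadraticTwist (NumberField.discr K : ℚ)).entireLFunction := by
    rw [← hWd, entireLFunction_smul]
  have hLd : Wd.entireLFunction 1 ≠ 0 := by rw [hLeq]; exact hLt
  have hrd : Wd.analyticRank = 0 := (Wd.analyticRank_eq_zero_iff_holds (hmod Wd)).2 hLd
  have hT2 : NoRationalTwoTorsion W := noRationalTwoTorsion_of_odd_torsionOrder W hT
  have hW2 : ∀ T : W.toAffine.Point, 2 • T = 0 → T = 0 := EggDoubling.eq_zero_of_two_smul_eq_zero W hT2
  have hWd2 : ∀ T : Wd.toAffine.Point, 2 • T = 0 → T = 0 := by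
    have hbotW : AddSubgroup.torsionBy W.toAffine.Point (2 : ℤ) = ⊥ :=
      Summit.BirchSwinnertonDyer.Uniform.U2.torsionBy_two_eq_bot_iff.mpr hW2
    have hbotWd := Summit.BirchSwinnertonDyer.Uniform.U2.torsionBy_two_eq_bot_of_twist W hD0 Wd ⟨Cd⁻¹, by
      rw [← hWd, inv_smul_smul]⟩ hbotW
    exact Summit.BirchSwinnertonDyer.Uniform.U2.torsionBy_two_eq_bot_iff.mp hbotWd
  have hTdodd : Odd Wd.torsionOrder := by
    rw [← Nat.not_even_iff_odd, even_iff_two_dvd]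
    intro hdvd
    obtain ⟨T, hT'⟩ := exists_addOrderOf_eq_of_dvd_torsionOrder Wd 2 hdvd
    have h2T : 2 • T = 0 := by
      have h := addOrderOf_nsmul_eq_zero T
      rwa [hT'] at h
    have hT0 : T = 0 := hWd2 T h2T
    rw [hT0, addOrderOf_zero] at hT'
    exact absurd hT' (by norm_num)
  have hvTd : padicValNat 2 Wd.torsionOrder = 0 :=
    padicValNat.eq_zero_of_not_dvd (fun h => (Nat.not_even_iff_odd.mpr hTdodd) (even_iff_two_dvd.mpr h))
  have hvcWn : padicValNat 2 W.tamagawaProduct = 0 :=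
    padicValNat.eq_zero_of_not_dvd (fun h => (Nat.not_even_iff_odd.mpr hc) (even_iff_two_dvd.mpr h))
  have hvcd : padicValNat 2 Wd.tamagawaProduct =
      padicValNat 2 W.tamagawaProduct + transpCount W (NumberField.discr K) + 2 * identCount W (NumberField.discr K) :=
    doorTwistTamagawaAtTwo W (NumberField.discr K) hadm Wd Cd hWd
  -- `#Ш_an(Wd) = q_d · #Wd(ℚ)_tors² / ∏c_ℓ(Wd)`
  have hlead : Wd.leadingLCoeff = Wd.entireLFunction 1 := WeierstrassCurve.leadingLCoeff_eq_of_analyticRank_eq_zero Wd hrd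
  have hreg : Wd.regulator = 1 := Wd.regulator_eq_one_of_rank_zero hrkd
  have hΩdpos : 0 < Wd.realPeriodRat := Wd.realPeriodRat_pos_holds
  have hΩdC : (Wd.realPeriodRat : ℂ) ≠ 0 := by exact_mod_cast hΩdpos.ne'
  have hTd0 : 0 < Wd.torsionOrder := Wd.torsionOrder_pos_holds
  have hcd0 : 0 < Wd.tamagawaProduct := Wd.tamagawaProduct_pos_holds
  have hTq : (Wd.torsionOrder : ℚ) ≠ 0 := by exact_mod_cast hTd0.ne'
  have hcq : (Wd.tamagawaProduct : ℚ) ≠ 0 := by exact_mod_cast hcd0.ne'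
  set q' : ℚ := qd * (Wd.torsionOrder : ℚ) ^ 2 / Wd.tamagawaProduct with hq'_def
  have hq' : shaAn Wd = (q' : ℂ) := by
    have hTC : (Wd.torsionOrder : ℂ) ≠ 0 := by exact_mod_cast hTd0.ne'
    have hcC : (Wd.tamagawaProduct : ℂ) ≠ 0 := by exact_mod_cast hcd0.ne'
    have hL1 : Wd.entireLFunction 1 = (qd : ℂ) * (Wd.realPeriodRat : ℂ) := by
      rw [← hqd, div_mul_cancel₀ _ hΩdC]
    rw [shaAn_def, hlead, hreg, Complex.ofReal_one, mul_one, hL1, hq'_def]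
    push_cast
    field_simp
  have hq'0 : q' ≠ 0 := by
    rw [hq'_def]; exact div_ne_zero (mul_ne_zero hqd0 (pow_ne_zero _ hTq)) hcq
  have hvq' : padicValRat 2 q' = padicValRat 2 qd -
      ((transpCount W (NumberField.discr K) : ℤ) + 2 * (identCount W (NumberField.discr K) : ℤ)) := by
    rw [hq'_def, padicValRat.div (mul_ne_zero hqd0 (pow_ne_zero _ hTq)) hcq, padicValRat.mul hqd0 (pow_ne_zero _ hTq),
      padicValRat.pow, padicValRat.of_nat, padicValRat.of_nat, hvTd, hvcd, hvcWn]
    push_cast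
    ring
  refine ⟨hrkd, hexm, q, q', hq, hq', hq0, hq'0, fun m hm => ?_⟩
  have hv := hval m hm
  rw [hvq']
  linarith

/-! ### §2 The analytic `Ш` orders of a door pair have the same `2`-adic parity -/

/-- **`ord₂ #Ш_an(W) + ord₂ #Ш_an(Wd)` IS EVEN for a door pair — PRINT only** (Gross–Zagier, Kolyvagin, modularity as a newform; the
proved twist Tamagawa law and the lead's proved parity `t ≡ [Δ_W<0] (mod 2)`): in the setting of `pairShaAnLedger_at`, for all rational
values `q`, `q'` of `#Ш_an(W)`, `#Ш_an(Wd)`.  BSD + Cassels–Tate predict both are squares; this `2`-adic shadow is unconditional modulo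
PRINT.  A violation in a census row would be a data or transcription error, not a counterexample to anything open.
[cite: GrossZagier1986, V.§2] [cite: Kramer1981, Prop. 3] -/
theorem even_padicValRat_shaAn_add_shaAn_twin_at (hnf : exists_isNewformOf)
    (W : WeierstrassCurve ℚ) [W.IsElliptic] [W.IsGloballyMinimal] [NeZero (W.conductorNorm ℤ)]
    (hT : Odd W.torsionOrder) (hc : Odd W.tamagawaProduct) (hr : W.analyticRank = 1) (hrQ : W.mordellWeilRank = 1)
    (K : Type) [Field K] [NumberField K] (hK : IsImaginaryQuadratic K)
    (hGZ : gross_zagier (W.conductorNorm ℤ) W K) (hKo : kolyvagin (W.conductorNorm ℤ) W K)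
    (hadm : DoorAdmissible W (NumberField.discr K))
    (hHN : SatisfiesHeegnerHypothesis (W.conductorNorm ℤ) K)
    (hLt : (W.quadraticTwist (NumberField.discr K : ℚ)).entireLFunction 1 ≠ 0)
    (Dt : ModularParametrizationData W (W.conductorNorm ℤ))
    (H : HeegnerDatum (W.conductorNorm ℤ) (NumberField.discr K)) (ι : K →+* ℂ)
    (P : (W.baseChange K).toAffine.Point)
    (hP : WeierstrassCurve.Affine.Point.map ι.toRatAlgHom P = heegnerPointComplex Dt H)
    (Wd : WeierstrassCurve ℚ) [Wd.IsElliptic] [Wd.IsGloballyMinimal] (Cd : VariableChange ℚ)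
    (hWd : Cd • W.quadraticTwist (NumberField.discr K : ℚ) = Wd)
    (q q' : ℚ) (hq : shaAn W = (q : ℂ)) (hq' : shaAn Wd = (q' : ℂ)) :
    Even (padicValRat 2 q + padicValRat 2 q') := by
  obtain ⟨-, ⟨m, hm⟩, q₀, q₀', hq₀, hq₀', -, -, hval⟩ :=
    pairShaAnLedger_at hnf W hT hc hr hrQ K hK hGZ hKo hadm hHN hLt Dt H ι P hP Wd Cd hWd
  have hqq : q = q₀ := by exact_mod_cast hq.symm.trans hq₀
  have hqq' : q' = q₀' := by exact_mod_cast hq'.symm.trans hq₀'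
  subst hqq hqq'
  have hv := hval m hm
  have ht := transpCount_mod_two_of_doorAdmissible W hadm
  have ht' : (transpCount W (NumberField.discr K) : ℤ) =
      2 * ((transpCount W (NumberField.discr K) / 2 : ℕ) : ℤ) + ((if W.Δ < 0 then 1 else 0 : ℕ) : ℤ) := by
    have h := Nat.div_add_mod (transpCount W (NumberField.discr K)) 2
    rw [ht] at h
    exact_mod_cast h.symm
  refine ⟨(m : ℤ) - padicValInt 2 Dt.c - ((transpCount W (NumberField.discr K) / 2 : ℕ) : ℤ) -
    identCount W (NumberField.discr K), ?_⟩
  rw [ht'] at hv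
  linarith

/-! ### §3 On the slice: every curve has a door twin of the same `Ш_an`-parity -/

/-- **For every globally minimal `W` of analytic rank `1` with odd torsion and odd Tamagawa product (in particular every `W` on the slice
of 23715) there is a door twin `Wd` (Hoffstein–Luo door, minimal model) with `ord₂ #Ш_an(W) + ord₂ #Ш_an(Wd)` EVEN**, modulo the four
primary facts only (`gross_zagier`, `kolyvagin`, `exists_isNewformOf`, Hoffstein–Luo 1997).  Conditional by design; no `BSD₂` input, no
Cassels–Tate; the slice's big-image / non-CM binders are not needed. [cite: GrossZagier1986, V.§2] [cite: Kramer1981, Prop. 3] -/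
theorem exists_twin_even_padicValRat_shaAn_add_onSlice
    (hGZ : ∀ (N : ℕ) [NeZero N] (W : WeierstrassCurve ℚ) (K : Type) [Field K] [NumberField K], gross_zagier N W K)
    (hKo : ∀ (N : ℕ) [NeZero N] (W : WeierstrassCurve ℚ) (K : Type) [Field K] [NumberField K], kolyvagin N W K)
    (hnf : exists_isNewformOf) (hHL : HoffsteinLuo1997_exists_twist_L_one_ne_zero)
    (W : WeierstrassCurve ℚ) [W.IsElliptic] [W.IsGloballyMinimal] (hT : Odd W.torsionOrder) (hc : Odd W.tamagawaProduct)
    (hr : W.analyticRank = 1) :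
    ∃ (d : ℤ) (Cd : VariableChange ℚ), DoorAdmissible W d ∧ (W.quadraticTwist (d : ℚ)).entireLFunction 1 ≠ 0 ∧
      (Cd • W.quadraticTwist (d : ℚ)).IsElliptic ∧
      ∃ _ : (Cd • W.quadraticTwist (d : ℚ)).IsGloballyMinimal,
        ∀ q q' : ℚ, shaAn W = (q : ℂ) → shaAn (Cd • W.quadraticTwist (d : ℚ)) = (q' : ℂ) →
          Even (padicValRat 2 q + padicValRat 2 q') := by
  haveI hN : NeZero (W.conductorNorm ℤ) := ⟨(W.conductorNorm_pos_holds).ne'⟩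
  have hmod : hasEntireLFunction_rat := hasEntireLFunction_rat_of_exists_isNewformOf hnf
  have hrk : W.mordellWeilRank = 1 :=
    (mordellWeilRank_eq_one_of_analyticRank_eq_one_of_isGloballyMinimal hGZ hKo hnf hHL W hr).1
  obtain ⟨K, _iF, _iN, hK, hadm, hLt, -, hHN⟩ := doorSupplyAnalyticAtTwo_of_hoffsteinLuo hnf hHL W hr
  obtain ⟨Dt⟩ := (nonempty_modularParametrizationData_iff_exists_isNewformOf_unconditional.mpr hnf) W
  obtain ⟨H, -⟩ :=
    nonempty_heegnerDatum_holds (W.conductorNorm ℤ) K hK (exists_dvd_sq_sub_discr_holds (W.conductorNorm ℤ) K hK hHN).choose_spec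
  obtain ⟨ι⟩ : Nonempty (K →+* ℂ) := inferInstance
  obtain ⟨P, hP⟩ := heegnerPointComplex_mem_range_map_holds (W.conductorNorm ℤ) W K hK hHN Dt H ι
  have hD0 : (NumberField.discr K : ℚ) ≠ 0 := by exact_mod_cast NumberField.discr_ne_zero K
  haveI hEt : (W.quadraticTwist (NumberField.discr K : ℚ)).IsElliptic := W.isElliptic_quadraticTwist hD0
  obtain ⟨Cd, hCd⟩ := hasGlobalMinimalModel_rat_holds (W.quadraticTwist (NumberField.discr K : ℚ))
  haveI : (Cd • W.quadraticTwist (NumberField.discr K : ℚ)).IsGloballyMinimal := hCd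
  refine ⟨NumberField.discr K, Cd, hadm, hLt, inferInstance, hCd, fun q q' hq hq' => ?_⟩
  exact even_padicValRat_shaAn_add_shaAn_twin_at hnf W hT hc hr hrk K hK (hGZ _ W K) (hKo _ W K) hadm hHN hLt Dt H ι P hP
    (Cd • W.quadraticTwist (NumberField.discr K : ℚ)) Cd rfl q q' hq hq'

end Summit.BirchSwinnertonDyer.BirchSwinnertonDyer.Theorems.RankOneAtTwoOneDoor

end
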